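import Summits.BirchSwinnertonDyer.BirchSwinnertonDyer.Theorems.SmallImageMuTransferMuTransferX9StepsTwoFourAssembly
import Summits.BirchSwinnertonDyer.BirchSwinnertonDyer.Theorems.SmallImageMuTransferMuTransferX9TameClassLevel
import HarnessLib

/-!
# K6 crux `MuTransferX9` (stmt-BirchSwinnertonDyer-19276), skeleton v6: the ASSEMBLY of `stub_stepsTwoFourOdd`
# with clause (I0) DISCHARGED — `stub_stepsTwoFourOdd_of'` from the Kolyvagin package WITHOUT (I0)

Cell `bsd-smallim`, seat `bsd-smallim-k6-lur-b` (gen 0; assembler).  HONEST FRAMING: theorems only (no definition,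
no named fact, no `sorry`); nothing is asserted about any curve and nothing is booked.  Sibling of p472462
`…X9StepsTwoFourAssembly` (`StepsTwoFour.stub_stepsTwoFourOdd_of (hKoly)`): the clause (I0) of `hKoly` — «the
Euler-system tower class `(I.redTower s)_J` is unramified at `q`» — is PROVED generically by koly's p470496
`TameClass.localization_redTower_mem_unramifiedSubgroup` (every `x ∈ 𝐇¹_Γ`, every level, every `q ∤ p` with
`E[p]` unramified), so the discharge owner (x10 g39, plan g11 l.349/l.350) may target the SHORTER hypothesis
`hKolyNoI0` (= `hKoly` minus (I0), text HOME/lurb/STEPS24-hKolyNoI0.lean.txt):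
`stub_stepsTwoFourOdd_of' (hKolyNoI0) : <stub_stepsTwoFourOdd VERBATIM>` (enlarge the producer's `S₀` by x9
p455730's set, off which `q ∤ p` and `E[p]` is unramified, and feed (I0) from koly's lemma).  Either door closes
the stub.

PARTITION (D-0054): X9 (A4) × p ∈ {5,7} (+ X10b∧¬Surj at 3) — helper toward `stub_stepsTwoFourOdd`; closes none.

References: HOME/koly/MU-TRANSFER-PROOF.md §§2–5; B. Mazur, K. Rubin, Mem. AMS 799 (2004) §5.3 [MazurRubin2004];
K. Kato, Astérisque 295 (2004) (8.1.3), §13 [Kato2004Asterisque].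
-/

set_option linter.dupNamespace false
set_option autoImplicit false

noncomputable section

open scoped NumberField ContRepresentation
open CategoryTheory Function Finset Polynomial
open Field IsDedekindDomain NumberField
open Literature.NumberTheory.GaloisRepresentations
open Literature.NumberTheory.GaloisRepresentations.IsNonarchimedeanLocalField
open Literature.NumberTheory.GaloisCohomology
open Literature.NumberTheory.EllipticCurves
open Literature.NumberTheory.EllipticCurves.Kato2004
open Literature.NumberTheory.EllipticCurves.Kato2004.EulerSystemValues
open Rat.HeightOneSpectrum
open Summit.BirchSwinnertonDyer.Rank1Residual.GaloisImage

namespace Summit.BirchSwinnertonDyer.BirchSwinnertonDyer.Rank1Residual.StepsTwoFour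

/-- **The registered stub `stub_stepsTwoFourOdd` from the Kolyvagin package WITHOUT (I0)** (the tower
class's unramifiedness at `q` is supplied by koly's `TameClass.localization_redTower_mem_unramifiedSubgroup`
after enlarging the exceptional set by x9's `TorsionUnramified.exists_finite_isUnramifiedAt_torsionGaloisModule`).
[cite: MazurRubin2004, §5.3] [cite: Kato2004Asterisque, (8.1.3), §8.2 and Lemma 8.5 (pp. 180–184)] -/
theorem stub_stepsTwoFourOdd_of'
    (hKolyNoI0 : ∀ (W : WeierstrassCurve ℚ) [W.IsElliptic] [W.IsGloballyMinimal] (p : ℕ) [Fact p.Prime]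
      [ContinuousSMul ℤ_[p] (W.tateModule p)] [Module.Free ℤ_[p] (W.tateModule p)]
      [Module.Finite ℤ_[p] (W.tateModule p)] (κ : ZpExtension ℚ p) (γ : absoluteGaloisGroup ℚ)
      (I : IwasawaH1Data W p κ γ), p ≠ 2 → W.HasIrreducibleModPGaloisRep p → ¬ W.HasSurjectiveModNGaloisRep p →
      κ.IsCyclotomic → κ.IsTopGenerator γ → ∀ (s : I.H), IsEulerSystemClass W p κ γ I s →
      ∃ (S₀ : Set (HeightOneSpectrum (𝓞 ℚ))), S₀.Finite ∧
      ∀ (a : ℕ) (κ' : κ.twistTower (W.torsionGaloisModule (p : ℤ))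
          (fun P : WeierstrassCurve.geomTorsion W (p : ℤ) => AddSubgroup.torsionBy.nsmul P)),
        (κ.towerShift (W.torsionGaloisModule (p : ℤ))
          (fun P : WeierstrassCurve.geomTorsion W (p : ℤ) => AddSubgroup.torsionBy.nsmul P))^[a] κ' = I.redTower s →
      ∀ (n e' : ℕ), e' + 1 = p ^ n →
      ∀ (Φ : contOneCocycles (W.modPTwist p κ (2 * e' + 1 + 1)).toTopRep),
        oneCocycleClass (W.modPTwist p κ (2 * e' + 1 + 1)).toTopRep Φ = κ'.1 (2 * e' + 1 + 1) →
      ∀ (q : HeightOneSpectrum (𝓞 ℚ)), q ∉ S₀ →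
      ∀ [NeZero ((primesEquiv q : Nat.Primes) : ℕ)] [Fact (((primesEquiv q : Nat.Primes) : ℕ)).Prime]
        [NeZero ((((primesEquiv q : Nat.Primes) : ℕ) : ℕ) : q.adicCompletion ℚ)]
        [(rootsOfUnityFixer ℚ ((primesEquiv q : Nat.Primes) : ℕ)).Normal]
        [Fintype (absoluteGaloisGroup ℚ ⧸ rootsOfUnityFixer ℚ ((primesEquiv q : Nat.Primes) : ℕ))],
      ∀ 𝔓 ∈ q.primesAbove, ∀ (Fr : absoluteGaloisGroup ℚ), IsArithFrobAt (𝓞 ℚ) Fr 𝔓 →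
        WeierstrassCurve.galoisRepTorsion W p Fr = 1 → Fr ∈ κ.layerSubgroup n → Fr ∉ κ.layerSubgroup (n + 1) →
      -- the KOLYVAGIN PACKAGE at `q`: a global cocycle `c` (the Kolyvagin class `κ_q` at level `J`), a tame
      -- generator `τq ∈ I_{ℚ_q}` read through `χ̄_ℓ`, a local arithmetic Frobenius `r`, and the VALUE identity
      ∃ (c : contOneCocycles (W.modPTwist p κ (2 * e' + 1 + 1)).toTopRep)
        (τq r : absoluteGaloisGroup (q.adicCompletion ℚ)),
        τq ∈ absInertia (q.adicCompletion ℚ) ∧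
        (∀ u : (ZMod ((primesEquiv q : Nat.Primes) : ℕ))ˣ,
          u ∈ Subgroup.zpowers (modPCyclotomicCharacterZMod (q.adicCompletion ℚ)
            ((primesEquiv q : Nat.Primes) : ℕ) τq)) ∧
        (∀ w : HeightOneSpectrum (𝓞 ℚ), w ≠ q → ((p : ℕ) : 𝓞 ℚ) ∉ w.asIdeal →
          GaloisRep.IsUnramifiedAt w (W.torsionGaloisModule (p : ℤ)) →
          galoisCohomology.localization (W.modPTwist p κ (2 * e' + 1 + 1)) (Sum.inr w) 1
              (oneCocycleClass (W.modPTwist p κ (2 * e' + 1 + 1)).toTopRep c) ∈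
            DiscreteGaloisModule.unramifiedSubgroup
              (GaloisRep.toLocal w (W.modPTwist p κ (2 * e' + 1 + 1))) 1) ∧
        galoisCohomology.localization (W.modPTwist p κ (2 * e' + 1 + 1)) (Sum.inr q) 1
            (oneCocycleClass (W.modPTwist p κ (2 * e' + 1 + 1)).toTopRep c) ∈
          DiscreteGaloisModule.transverseSubgroup (GaloisRep.toLocal q (W.modPTwist p κ (2 * e' + 1 + 1)))
            (CyclotomicField ((primesEquiv q : Nat.Primes) : ℕ) (q.adicCompletion ℚ)) ∧
        IsAbsArithFrob r ∧
        ∃ U : Polynomial ℤ, ¬ ((p : ℤ) ∣ U.coeff 0) ∧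
          c.1 (absGaloisRestrict ℚ (q.adicCompletion ℚ) τq) =
            Polynomial.aeval (shiftEnd (WeierstrassCurve.geomTorsion W (p : ℤ)) (2 * e' + 1 + 1)) U
              ((shiftEnd (WeierstrassCurve.geomTorsion W (p : ℤ)) (2 * e' + 1 + 1) ^ (e' + 1))
                ((shiftEnd (WeierstrassCurve.geomTorsion W (p : ℤ)) (2 * e' + 1 + 1) ^ a)
                  (Φ.1 (absGaloisRestrict ℚ (q.adicCompletion ℚ) r))))) :
    ∀ (W : WeierstrassCurve ℚ) [W.IsElliptic] [W.IsGloballyMinimal] (p : ℕ) [Fact p.Prime] [ContinuousSMul ℤ_[p] (W.tateModule p)] [Module.Free ℤ_[p] (W.tateModule p)] [Module.Finite ℤ_[p] (W.tateModule p)] (κ : ZpExtension ℚ p) (γ : absoluteGaloisGroup ℚ) (I : IwasawaH1Data W p κ γ), p ≠ 2 → W.HasIrreducibleModPGaloisRep p → ¬ W.HasSurjectiveModNGaloisRep p → κ.IsCyclotomic → κ.IsTopGenerator γ → poitouTate_sum_localTatePairing_eq_zero ℚ → ∀ (s : I.H), IsEulerSystemClass W p κ γ I s → ∃ (S₀ :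 Set (HeightOneSpectrum (𝓞 ℚ))), S₀.Finite ∧ ∀ (a : ℕ) (κ' : κ.twistTower (W.torsionGaloisModule (p : ℤ)) (fun P : WeierstrassCurve.geomTorsion W (p : ℤ) => AddSubgroup.torsionBy.nsmul P)), (κ.towerShift (W.torsionGaloisModule (p : ℤ)) (fun P : WeierstrassCurve.geomTorsion W (p : ℤ) => AddSubgroup.torsionBy.nsmul P))^[a] κ' = I.redTower s → ∀ (n e' : ℕ), e' + 1 = p ^ n → ∀ (Φ : contOneCocycles (W.modPTwist p κ (2 * e' + 1 + 1)).toTopRep), oneCocycleClass (W.modPTwist p κ (2 * e' + 1 + 1)).toTopRep Φ = κ'.1 (2 * e' + 1 + 1) → ∀ (ε : ℕ) (S₁ : Set (HeightOneSpectrum (𝓞 ℚ))) (Ψ : galoisCohomology (W.modPTwist p κ.invTwist (2 * e' + 1 + 1)) 1) (Ψc : contOneCocycles (W.modPTwist p κ.invTwist (2 * e' + 1 + 1)).toTopRep), S₀ ⊆ S₁ → oneCocycleClass (W.modPTwist p κ.invTwist (2 * e' + 1 + 1)).toTopRep Ψc = Ψ → (∀ v : HeightOneSpectrum (𝓞 ℚ),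 v ∉ S₁ → galoisCohomology.localization (W.modPTwist p κ.invTwist (2 * e' + 1 + 1)) (Sum.inr v) 1 Ψ ∈ DiscreteGaloisModule.unramifiedSubgroup (GaloisRep.toLocal v (W.modPTwist p κ.invTwist (2 * e' + 1 + 1))) 1) → (∀ v : HeightOneSpectrum (𝓞 ℚ), v ∈ S₁ → galoisCohomology.localization (W.modPTwist p κ.invTwist (2 * e' + 1 + 1)) (Sum.inr v) 1 ((κ.invTwist.shiftH1 (W.torsionGaloisModule (p : ℤ)) (fun P : WeierstrassCurve.geomTorsion W (p : ℤ) => AddSubgroup.torsionBy.nsmul P) (2 * e' + 1 + 1))^[ε] Ψ) = 0) → ∀ (eW : WeierstrassCurve.geomTorsion W (p : ℤ) → WeierstrassCurve.geomTorsion W (p : ℤ) → AlgebraicClosure ℚ) (hμ : ∀ S T, eW S T ^ p = 1) (hadd₁ : ∀ S₁' S₂' T, eW (S₁' + S₂') T = eW S₁' T * eW S₂' T) (hadd₂ : ∀ S T₁ T₂, eW S (T₁ + T₂) = eW S T₁ * eW S T₂), (∀ T, eW T T = 1) → (∀ T, (∀ S, eW S T = 1) → T = 0) → (∀ (σ : absoluteGaloisGroup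 ℚ) (S T : WeierstrassCurve.geomTorsion W (p : ℤ)), σ • eW S T = eW (σ • S) (σ • T)) → ∀ (q : HeightOneSpectrum (𝓞 ℚ)), q ∉ S₁ → ∀ 𝔓 ∈ q.primesAbove, ∀ (Fr : absoluteGaloisGroup ℚ), IsArithFrobAt (𝓞 ℚ) Fr 𝔓 → WeierstrassCurve.galoisRepTorsion W p Fr = 1 → Fr ∈ κ.layerSubgroup n → Fr ∉ κ.layerSubgroup (n + 1) → ∃ U : Polynomial ℤ, ¬ ((p : ℤ) ∣ U.coeff 0) ∧ ∀ i : ℕ, i + ε < 2 * e' + 1 + 1 → convCoeff (weilPairingHom W p eW hμ hadd₁ hadd₂) (2 * e' + 1 + 1) i (Polynomial.aeval (shiftEnd (WeierstrassCurve.geomTorsion W (p : ℤ)) (2 * e' + 1 + 1)) U ((shiftEnd (WeierstrassCurve.geomTorsion W (p : ℤ)) (2 * e' + 1 + 1) ^ (e' + 1 + a)) (Φ.1 Fr))) (Ψc.1 Fr) = 0 := by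
  refine stub_stepsTwoFourOdd_of ?_
  intro W _ _ p _ _ _ _ κ γ I hp2 hirr hns hκ hγ s hES
  have hp : p.Prime := Fact.out
  obtain ⟨S₀', hS₀'fin, hK⟩ := hKolyNoI0 W p κ γ I hp2 hirr hns hκ hγ s hES
  obtain ⟨S₀'', hS₀''fin, hS₀''⟩ :=
    TorsionUnramified.exists_finite_isUnramifiedAt_torsionGaloisModule W (K := ℚ) (p := p) hp.ne_zero
  refine ⟨S₀' ∪ S₀'', hS₀'fin.union hS₀''fin, ?_⟩
  intro a κ' hκ' n e' he' Φ hΦ q hq _ _ _ _ _ 𝔓 h𝔓 Fr hFr hρ hFrn hFrn'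
  obtain ⟨hqp, -, hur⟩ := hS₀'' q fun h => hq (Or.inr h)
  refine ⟨?_, hK a κ' hκ' n e' he' Φ hΦ q (fun h => hq (Or.inl h)) 𝔓 h𝔓 Fr hFr hρ hFrn hFrn'⟩
  exact TameClass.localization_redTower_mem_unramifiedSubgroup W p κ γ I s (2 * e' + 1 + 1) hqp hur

end Summit.BirchSwinnertonDyer.BirchSwinnertonDyer.Rank1Residual.StepsTwoFour

end
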